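import Literature.Combinatorics.Optimization.ShellLawRelativeLevelSmoothness
import Literature.Combinatorics.Optimization.ShellLawRelabeling
import HarnessLib

/-!
# Pointwise relative level-smoothness of the shell law on an ARBITRARY `π`-stable ground set

`ShellLawRelativeLevelSmoothness.abs_fwdDiff_iter_shellLaw_le_of_hyps` (cell pnp-psdrank's [BULK] export, prover g26) is
stated for the full ground set `univ` of a perfect matching on `Fin n`. Its consumers (prover MEMO-30 §3; eng brick 135's
budgets `R₁, R₂`) need it for the laws of DELETED ground sets `S ∖ e_v`, `S ∖ e_v ∖ e_w` — sub-matchings. By the relabeling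
transport `ShellLawRelabeling.exists_relabel_shellLaw` (a `π`-stable `S` with `|S| = m` is the image of a strictly monotone
`f : Fin m ↪ Fin n` intertwining a fixed-point-free involution `π′` on `Fin m`; laws, shell sizes, type counts and the block size
agree) the statement transfers VERBATIM, with `n ↦ |S|`, `H.card ↦ |S ∩ H|` and the type counts measured on `S`:

* **`abs_fwdDiff_iter_shellLaw_le_of_hyps_sub`** — the quantitative per-order bound
  `(C(2k,k)/4^k)|Δ^k_j law_S(2s+1,2j+1;x)|(0) ≤ Γ·q^k·law_S(2s+1,1;x) + (4/3)^k·exp(−(L−2D)²/(4N₀))` for `1 ≤ k ≤ D`, under the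
  hypotheses of the `univ` theorem for the sub-matching (`|S| = 2N₀`, types `(a,b,d)` of `(S,H)`, the same margins).

No new mathematics; 0 sorry, no definitions, no named facts (eng g25). [cite: Rothvoss2017, §2 (PDF p. 6)] [cite: RollinRoss2010, §4.1 Thm 4.2]
-/

noncomputable section

open Finset

namespace Literature.Combinatorics.Optimization

namespace ShellStep

variable {n : ℕ} {π : Fin n → Fin n}

/-- **Relative level-smoothness of the shell law on a `π`-stable sub-ground-set** (`abs_fwdDiff_iter_shellLaw_le_of_hyps`
transported by `exists_relabel_shellLaw`). For a fixed-point-free involution `π` on `Fin n`, a `π`-stable `S` with `|S| = 2N₀`,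
a block `H` with `(S,H)`-type counts `(a,b,d)` (`a+b+d = N₀`), and the margins of the `univ` theorem (with `H.card/n` replaced by
`|S ∩ H|/|S|`): for every `1 ≤ k ≤ D`,
`(C(2k,k)/4^k)·|Δ^k_j[law_S(2s+1,2j+1;x)](0)| ≤ Γ·q^k·law_S(2s+1,1;x) + (4/3)^k·exp(−(L−2D)²/(4N₀))` with the `univ` theorem's `Γ, q`.
[cite: Rothvoss2017, §2 (PDF p. 6)] [cite: RollinRoss2010, §4.1 Thm 4.2] -/
theorem abs_fwdDiff_iter_shellLaw_le_of_hyps_sub (hπ : ∀ v, π (π v) = v) (hπ' : ∀ v, π v ≠ v)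
    {S : Finset (Fin n)} (hS : ∀ v ∈ S, π v ∈ S) (H : Finset (Fin n)) {a b d N₀ : ℕ}
    (ha : (reps π (vAA π S H)).card = a) (hb : (reps π (vBH π S H ∪ vBN π S H)).card = b)
    (hd : (reps π (vDD π S H)).card = d) (hN : a + b + d = N₀) (hn : S.card = 2 * N₀)
    {β : ℝ} (hβ : 0 < β) (hβ1 : β ≤ 1 / 4) {D : ℕ} (hDN : 16 * D + 16 ≤ N₀)
    (hbβ : β * N₀ + 2 * D + 1 ≤ b) (hdβ : β * N₀ + 2 * D + 1 ≤ d)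
    {s : ℕ} (hs : β * N₀ + D ≤ s) (hs' : 8 * (s : ℝ) ≤ (4 + β) * ((N₀ : ℝ) - 2 * D))
    (hne : ∀ k, k ≤ D → (shellIn π S (2 * s + 1) (1 + 2 * k)).Nonempty)
    {x : ℕ} {ε : ℝ} (hxε : |(x : ℝ) - (2 * (s : ℝ) + 1) * (S ∩ H).card / S.card| < ε) (hxD : 2 * D ≤ x)
    {L : ℝ} (h2D : 2 * (D : ℝ) ≤ L) (hLN : 2 * L ≤ N₀)
    (h1 : L + D + (ε + 14 * D + 1) ≤ β ^ 2 * N₀)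
    (h2 : L + D + (ε + 14 * D + 1) + 3 ≤ β * ((N₀ : ℝ) - 2 * D) / 8)
    (h3 : 2 * (L + D + 1) ≤ (β ^ 2 / 8) ^ 2 * (β * ((N₀ : ℝ) - 2 * D)))
    (h4 : 4 ≤ β * ((N₀ : ℝ) - 2 * D))
    (h5 : (D : ℝ) * (1 + 8 * (L + D + 1) / ((β ^ 2 / 8) ^ 4 * (β * ((N₀ : ℝ) - 2 * D)))) ≤
      (β ^ 2 / 8) ^ 4 * (β * ((N₀ : ℝ) - 2 * D))) :
    ∀ k ∈ Ico 1 (D + 1), (((2 * k).choose k : ℕ) : ℝ) / (4 : ℝ) ^ k *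
        |(fwdDiff (1 : ℕ))^[k] (fun j => shellLaw π S H (2 * s + 1) (2 * j + 1) x) 0| ≤
      (1 + 4 * (Real.sqrt N₀ + 1) / 3 *
          (2 * Real.sqrt 192 * Real.sqrt (2 * (2 * (D : ℝ) + 1) * (1 + 8 * (L + D + 1) / ((β ^ 2 / 8) ^ 4 * (β * ((N₀ : ℝ) - 2 * D)))) /
            ((β ^ 2 / 8) ^ 4 * (β * ((N₀ : ℝ) - 2 * D)))))) *
          (4 * ((1 + 8 * (L + D + 1) / ((β ^ 2 / 8) ^ 4 * (β * ((N₀ : ℝ) - 2 * D)))) *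
          (8 * (L + D + 1) / ((β ^ 2 / 8) ^ 4 * (β * ((N₀ : ℝ) - 2 * D))) +
            2 * Real.sqrt 192 * Real.sqrt (2 * (2 * (D : ℝ) + 1) * (1 + 8 * (L + D + 1) / ((β ^ 2 / 8) ^ 4 * (β * ((N₀ : ℝ) - 2 * D)))) /
            ((β ^ 2 / 8) ^ 4 * (β * ((N₀ : ℝ) - 2 * D)))))) ^ 2 / (3 * β)) ^ k *
          shellLaw π S H (2 * s + 1) 1 x +
        (4 / 3 : ℝ) ^ k * Real.exp (-((L - 2 * D) ^ 2 / (4 * N₀))) := by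
  obtain ⟨f, π', hfS, hinv, hfix, hlaw, hcard, hAA, hB, hDD, hH⟩ := exists_relabel_shellLaw hπ hπ' hS rfl H
  -- transport every ingredient to the relabeled matching `π′` on `Fin |S|`
  have hlaw' : (fun j => shellLaw π S H (2 * s + 1) (2 * j + 1) x) =
      fun j => shellLaw π' univ (univ.filter fun i => f i ∈ H) (2 * s + 1) (2 * j + 1) x := by
    funext j; exact hlaw _ _ _
  rw [hlaw']
  intro k hk
  rw [hlaw (2 * s + 1) 1 x]
  have hne' : ∀ k, k ≤ D → (shellIn π' univ (2 * s + 1) (1 + 2 * k)).Nonempty := by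
    intro k hk
    rw [← card_pos, ← hcard]
    exact card_pos.2 (hne k hk)
  have hxε' : |(x : ℝ) - (2 * (s : ℝ) + 1) * (univ.filter fun i : Fin S.card => f i ∈ H).card / S.card| < ε := by
    rw [← hH]; exact hxε
  exact abs_fwdDiff_iter_shellLaw_le_of_hyps hinv hfix (univ.filter fun i => f i ∈ H) (hAA ▸ ha) (hB ▸ hb) (hDD ▸ hd) hN hn
    hβ hβ1 hDN hbβ hdβ hs hs' hne' hxε' hxD h2D hLN h1 h2 h3 h4 h5 k hk

/-- **The budget of a FAMILY of isomorphic sub-ground-sets** (the shape eng brick 135 consumes for the pinned law families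
`G(j) = Σ_{v ∈ V} law_{S_v}(2s+1, 2j+1; x)`, e.g. `S_v = S ∖ e_v` over `v ∈ reps(vAA)`): if every `S_v` satisfies the hypotheses of
`abs_fwdDiff_iter_shellLaw_le_of_hyps_sub` with the SAME numeric parameters, then for `1 ≤ k ≤ D`
`(C(2k,k)/4^k)·|Δ^k G(0)| ≤ Γ·q^k·G(0) + |V|·(4/3)^k·exp(−(L−2D)²/(4N₀))` (triangle inequality + linearity of `Δ^k`).
[cite: Rothvoss2017, §2 (PDF p. 6)] [cite: RollinRoss2010, §4.1 Thm 4.2] -/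
theorem abs_fwdDiff_iter_sum_shellLaw_le_of_hyps_sub (hπ : ∀ v, π (π v) = v) (hπ' : ∀ v, π v ≠ v)
    {ι : Type*} (V : Finset ι) (Sv : ι → Finset (Fin n)) (hS : ∀ v ∈ V, ∀ u ∈ Sv v, π u ∈ Sv v) (H : Finset (Fin n))
    {a b d N₀ : ℕ}
    (ha : ∀ v ∈ V, (reps π (vAA π (Sv v) H)).card = a) (hb : ∀ v ∈ V, (reps π (vBH π (Sv v) H ∪ vBN π (Sv v) H)).card = b)
    (hd : ∀ v ∈ V, (reps π (vDD π (Sv v) H)).card = d) (hN : a + b + d = N₀) (hn : ∀ v ∈ V, (Sv v).card = 2 * N₀)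
    {β : ℝ} (hβ : 0 < β) (hβ1 : β ≤ 1 / 4) {D : ℕ} (hDN : 16 * D + 16 ≤ N₀)
    (hbβ : β * N₀ + 2 * D + 1 ≤ b) (hdβ : β * N₀ + 2 * D + 1 ≤ d)
    {s : ℕ} (hs : β * N₀ + D ≤ s) (hs' : 8 * (s : ℝ) ≤ (4 + β) * ((N₀ : ℝ) - 2 * D))
    (hne : ∀ v ∈ V, ∀ k, k ≤ D → (shellIn π (Sv v) (2 * s + 1) (1 + 2 * k)).Nonempty)
    {x : ℕ} {ε : ℝ} (hxε : ∀ v ∈ V, |(x : ℝ) - (2 * (s : ℝ) + 1) * (Sv v ∩ H).card / (Sv v).card| < ε) (hxD : 2 * D ≤ x)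
    {L : ℝ} (h2D : 2 * (D : ℝ) ≤ L) (hLN : 2 * L ≤ N₀)
    (h1 : L + D + (ε + 14 * D + 1) ≤ β ^ 2 * N₀)
    (h2 : L + D + (ε + 14 * D + 1) + 3 ≤ β * ((N₀ : ℝ) - 2 * D) / 8)
    (h3 : 2 * (L + D + 1) ≤ (β ^ 2 / 8) ^ 2 * (β * ((N₀ : ℝ) - 2 * D)))
    (h4 : 4 ≤ β * ((N₀ : ℝ) - 2 * D))
    (h5 : (D : ℝ) * (1 + 8 * (L + D + 1) / ((β ^ 2 / 8) ^ 4 * (β * ((N₀ : ℝ) - 2 * D)))) ≤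
      (β ^ 2 / 8) ^ 4 * (β * ((N₀ : ℝ) - 2 * D))) :
    ∀ k ∈ Ico 1 (D + 1), (((2 * k).choose k : ℕ) : ℝ) / (4 : ℝ) ^ k *
        |(fwdDiff (1 : ℕ))^[k] (fun j => ∑ v ∈ V, shellLaw π (Sv v) H (2 * s + 1) (2 * j + 1) x) 0| ≤
      (1 + 4 * (Real.sqrt N₀ + 1) / 3 *
          (2 * Real.sqrt 192 * Real.sqrt (2 * (2 * (D : ℝ) + 1) * (1 + 8 * (L + D + 1) / ((β ^ 2 / 8) ^ 4 * (β * ((N₀ : ℝ) - 2 * D)))) /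
            ((β ^ 2 / 8) ^ 4 * (β * ((N₀ : ℝ) - 2 * D)))))) *
          (4 * ((1 + 8 * (L + D + 1) / ((β ^ 2 / 8) ^ 4 * (β * ((N₀ : ℝ) - 2 * D)))) *
          (8 * (L + D + 1) / ((β ^ 2 / 8) ^ 4 * (β * ((N₀ : ℝ) - 2 * D))) +
            2 * Real.sqrt 192 * Real.sqrt (2 * (2 * (D : ℝ) + 1) * (1 + 8 * (L + D + 1) / ((β ^ 2 / 8) ^ 4 * (β * ((N₀ : ℝ) - 2 * D)))) /
            ((β ^ 2 / 8) ^ 4 * (β * ((N₀ : ℝ) - 2 * D)))))) ^ 2 / (3 * β)) ^ k *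
          (∑ v ∈ V, shellLaw π (Sv v) H (2 * s + 1) 1 x) +
        V.card * ((4 / 3 : ℝ) ^ k * Real.exp (-((L - 2 * D) ^ 2 / (4 * N₀)))) := by
  intro k hk
  -- abbreviate the two constants
  obtain ⟨Γq, hΓq⟩ : ∃ e : ℝ, e = (1 + 4 * (Real.sqrt N₀ + 1) / 3 *
          (2 * Real.sqrt 192 * Real.sqrt (2 * (2 * (D : ℝ) + 1) * (1 + 8 * (L + D + 1) / ((β ^ 2 / 8) ^ 4 * (β * ((N₀ : ℝ) - 2 * D)))) /
            ((β ^ 2 / 8) ^ 4 * (β * ((N₀ : ℝ) - 2 * D)))))) *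
          (4 * ((1 + 8 * (L + D + 1) / ((β ^ 2 / 8) ^ 4 * (β * ((N₀ : ℝ) - 2 * D)))) *
          (8 * (L + D + 1) / ((β ^ 2 / 8) ^ 4 * (β * ((N₀ : ℝ) - 2 * D))) +
            2 * Real.sqrt 192 * Real.sqrt (2 * (2 * (D : ℝ) + 1) * (1 + 8 * (L + D + 1) / ((β ^ 2 / 8) ^ 4 * (β * ((N₀ : ℝ) - 2 * D)))) /
            ((β ^ 2 / 8) ^ 4 * (β * ((N₀ : ℝ) - 2 * D)))))) ^ 2 / (3 * β)) ^ k := ⟨_, rfl⟩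
  obtain ⟨τ, hτ⟩ : ∃ e : ℝ, e = (4 / 3 : ℝ) ^ k * Real.exp (-((L - 2 * D) ^ 2 / (4 * N₀))) := ⟨_, rfl⟩
  rw [← hΓq, ← hτ]
  -- per member
  have hv : ∀ v ∈ V, (((2 * k).choose k : ℕ) : ℝ) / (4 : ℝ) ^ k *
      |(fwdDiff (1 : ℕ))^[k] (fun j => shellLaw π (Sv v) H (2 * s + 1) (2 * j + 1) x) 0| ≤
      Γq * shellLaw π (Sv v) H (2 * s + 1) 1 x + τ := by
    intro v hvV
    have h := abs_fwdDiff_iter_shellLaw_le_of_hyps_sub hπ hπ' (hS v hvV) H (ha v hvV) (hb v hvV) (hd v hvV) hN (hn v hvV)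
      hβ hβ1 hDN hbβ hdβ hs hs' (hne v hvV) (hxε v hvV) hxD h2D hLN h1 h2 h3 h4 h5 k hk
    rw [← hΓq, ← hτ] at h
    exact h
  -- linearity of `Δ^k` over the family and the triangle inequality
  have hlin : (fwdDiff (1 : ℕ))^[k] (fun j => ∑ v ∈ V, shellLaw π (Sv v) H (2 * s + 1) (2 * j + 1) x) 0 =
      ∑ v ∈ V, (fwdDiff (1 : ℕ))^[k] (fun j => shellLaw π (Sv v) H (2 * s + 1) (2 * j + 1) x) 0 := by
    have e : (fun j => ∑ v ∈ V, shellLaw π (Sv v) H (2 * s + 1) (2 * j + 1) x) =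
        ∑ v ∈ V, fun j => shellLaw π (Sv v) H (2 * s + 1) (2 * j + 1) x := by
      funext j; simp only [Finset.sum_apply]
    rw [e, fwdDiff_iter_finsetSum, Finset.sum_apply]
  have hck : 0 ≤ (((2 * k).choose k : ℕ) : ℝ) / (4 : ℝ) ^ k := by positivity
  rw [hlin]
  calc (((2 * k).choose k : ℕ) : ℝ) / (4 : ℝ) ^ k *
        |∑ v ∈ V, (fwdDiff (1 : ℕ))^[k] (fun j => shellLaw π (Sv v) H (2 * s + 1) (2 * j + 1) x) 0|
      ≤ (((2 * k).choose k : ℕ) : ℝ) / (4 : ℝ) ^ k *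
        ∑ v ∈ V, |(fwdDiff (1 : ℕ))^[k] (fun j => shellLaw π (Sv v) H (2 * s + 1) (2 * j + 1) x) 0| :=
        mul_le_mul_of_nonneg_left (abs_sum_le_sum_abs _ _) hck
    _ = ∑ v ∈ V, (((2 * k).choose k : ℕ) : ℝ) / (4 : ℝ) ^ k *
        |(fwdDiff (1 : ℕ))^[k] (fun j => shellLaw π (Sv v) H (2 * s + 1) (2 * j + 1) x) 0| := by rw [mul_sum]
    _ ≤ ∑ v ∈ V, (Γq * shellLaw π (Sv v) H (2 * s + 1) 1 x + τ) := sum_le_sum hv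
    _ = Γq * ∑ v ∈ V, shellLaw π (Sv v) H (2 * s + 1) 1 x + V.card * τ := by
        rw [sum_add_distrib, mul_sum, sum_const, nsmul_eq_mul]

end ShellStep

end Literature.Combinatorics.Optimization

end
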